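import Literature.Geometry.Riemannian.HeatKernelUpperBound
import Literature.Geometry.Riemannian.HeatKernelGaussianIntegralBoundHCenter
import Literature.Geometry.Riemannian.MetricFlowWassersteinMonotoneGeneral
import Literature.Geometry.Riemannian.RicciFlowHConcentrationHolds
import Literature.Geometry.Riemannian.GaussianLemmaExponent
import Literature.Geometry.Riemannian.HeatKernelTailExponentialMoment
import Literature.Geometry.Riemannian.HeatKernelTwoSetConcentration
import HarnessLib

/-!
# Bamler's Gaussian lemma (Bamler 2020a, Lemma 7.x = arXiv v1 Lemma 28), `α`-claim form

The core of the proof of the Gaussian heat kernel bound (Bamler 2020a, Thm. 7.2, arXiv v1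
Thm. 25): the claim (7.17) of the source. Given `m ≥ 3`, `Λ ≥ 0`, `ε, Q, α > 0` there is a
threshold `Z̲(m, Λ, ε, Q, α)` such that, for a Ricci flow `(g_r)_{r ∈ [a,T]}` of a smooth family of
Riemannian metrics on a closed connected `m`-manifold, times `a < s < t < T` with `R ≥ R_min` on
`M × [s,t]` and `−R_min (t − s) ≤ Λ`, and `Z ≥ Z̲`: if the Gaussian bound

  `K(x',t';y',s) ≤ 2Z (t'−s)^{-m/2} e^{−𝒩*_s(x',t')} exp(−d_s(z',y')²/(Q(t'−s)))`

holds at every `H_m`-centre `(z', s)` of every `(x', t')` with `t' ∈ (s, (s+t)/2]`, then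

  `K(x,t;y₁,s) K(x,t;y₂,s) ≤ α Z (t−s)^{-m} e^{−2𝒩*_s(x,t)} exp(−d_s(y₁,y₂)²/((8+ε/2)(t−s)))`

for all `x, y₁, y₂`. (The source works at scale `s = 0, t = 1` after parabolic rescaling; here
everything is done at general scale, so no rescaling of the flow is needed.)

The proof is the argument of §7.3 of the source by contradiction: the upper bound of Thm. 7.1
(`exists_heatKernelFn_le_rpow_mul_exp_neg_kernelNashEntropy`) settles `d_s(y₁,y₂) < √(t−s)` and
bounds `K(·,t_θ;y_i,s)` through the entropy comparison at an `H_m`-centre `(z', t_θ)` of `(x,t)`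
(`kernelNashEntropy_sub_le_of_lintegral_edist_sq_le`, (7.19)); the reproduction formula splits
`K(x,t;y_i,s)` into the mass of the super-level sets `V_i` near `z'` plus an exponential tail
(`heatKernelFn_le_of_forall_le_exp_mul_edist`, (7.20)); Hein–Naber concentration produces
near-minimisers `v_i ∈ V_i` with `ν(V₁)ν(V₂) ≤ e^{1/2} exp(−d_θ(v₁,v₂)²/(8(t−t_θ)))`
(`exists_mem_real_mul_real_le_exp_neg_edist_sq`, (7.21)); the hypothesis at `(v_i, t_θ)` with
`H_m`-centres `(z_i, s)` gives (7.23); the variance bound `d_s(z₁,z₂) ≤ d_θ(v₁,v₂) + 2√(H_m(t_θ−s))`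
(`IsHCenter.edist_le_edist_add'`) gives the distance bookkeeping (7.25), and the elementary
exponent estimate `gaussianLemma_exponent_le` ((7.26)) closes the contradiction for `Z ≥ Z̲`.
Logarithms replace the real powers `(·)^{1+β}` of the source.

## References

* R. H. Bamler, *Entropy and heat kernel bounds on a Ricci flow background*, arXiv:2008.07093
  (2020), §7.3, Lemma 7.x (arXiv v1 Lemma 28) and its proof, (7.17)–(7.26). [Bamler2020Entropy]
-/

noncomputable section

open Set Filter Function MeasureTheory Measure
open scoped Manifold ContDiff Topology ENNReal NNReal

namespace Literature.Geometry.Riemannian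

open Lorentzian Lorentzian.PseudoRiemannianMetric MetricFlow

/-! ### Elementary real lemmas -/

/-- `−c u² + b u ≤ b²/(4c)` for `c > 0`. [folklore] -/
theorem neg_mul_sq_add_mul_le {c b u : ℝ} (hc : 0 < c) : -c * u ^ 2 + b * u ≤ b ^ 2 / (4 * c) := by
  rw [le_div_iff₀ (by positivity)]
  nlinarith [sq_nonneg (2 * c * u - b)]

/-- `(1 + β)³ ≤ 1 + 7β` for `0 ≤ β ≤ 1`. [folklore] -/
theorem one_add_pow_three_le {β : ℝ} (h0 : 0 ≤ β) (h1 : β ≤ 1) : (1 + β) ^ 3 ≤ 1 + 7 * β := by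
  nlinarith [mul_nonneg h0 h0, mul_nonneg (mul_nonneg h0 h0) h0, mul_le_mul_of_nonneg_left h1 h0]

/-- From `Z^{1−β} < K` with `Z > 0`, `0 < 1 − β`, `0 ≤ K`: `Z < K^{1/(1−β)}`. [folklore] -/
theorem lt_rpow_inv_of_rpow_lt {Z K e : ℝ} (hZ : 0 < Z) (he : 0 < e) (h : Z ^ e < K) : Z < K ^ (1 / e) := by
  have h1 : (Z ^ e) ^ (1 / e) < K ^ (1 / e) :=
    Real.rpow_lt_rpow (Real.rpow_nonneg hZ.le e) h (by positivity)
  rwa [← Real.rpow_mul hZ.le, mul_one_div_cancel he.ne', Real.rpow_one] at h1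


/-- `10 κ d ≤ 25 c₁²/θ + d²/τ` for `κ = c₁ θ^{-1/2} / √τ` (AM–GM). [folklore] -/
theorem ten_mul_kappa_mul_le {c₁ θ τ d : ℝ} (hθ : 0 < θ) (hτ : 0 < τ) :
    10 * (c₁ * θ ^ (-(1 : ℝ) / 2) / Real.sqrt τ) * d ≤ 25 * c₁ ^ 2 / θ + d ^ 2 / τ := by
  have hsτ : 0 < Real.sqrt τ := Real.sqrt_pos.2 hτ
  have hθpow : θ ^ (-(1 : ℝ) / 2) = (Real.sqrt θ)⁻¹ := by
    rw [Real.sqrt_eq_rpow, ← Real.rpow_neg hθ.le]; norm_num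
  have hsθ : 0 < Real.sqrt θ := Real.sqrt_pos.2 hθ
  rw [hθpow]
  have e1 : 25 * c₁ ^ 2 / θ = (5 * c₁ / Real.sqrt θ) ^ 2 := by
    rw [div_pow, mul_pow, Real.sq_sqrt hθ.le]; ring
  have e2 : d ^ 2 / τ = (d / Real.sqrt τ) ^ 2 := by
    rw [div_pow, Real.sq_sqrt hτ.le]
  have e3 : 10 * (c₁ * (Real.sqrt θ)⁻¹ / Real.sqrt τ) * d =
      2 * (5 * c₁ / Real.sqrt θ) * (d / Real.sqrt τ) := by
    field_simp; ring
  rw [e1, e2, e3]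
  nlinarith [sq_nonneg (5 * c₁ / Real.sqrt θ - d / Real.sqrt τ)]

/-! ### The `α`-claim (7.17) of the Gaussian lemma -/

section AlphaClaim

set_option maxHeartbeats 1600000 in
/-- **Bamler 2020a, Lemma 7.x (arXiv v1 Lemma 28), in the form of the claim (7.17) of its proof.**
For `m ≥ 3`, `Λ ≥ 0` and `ε, Q, α > 0` there is `Z̲` such that for every Ricci
flow on `[a,T]` of a smooth family of Riemannian metrics on a closed connected manifold modelled on
`ℝᵐ`, all `a < s < t < T` with `R ≥ R_min` on `M × [s,t]`, `−R_min(t−s) ≤ Λ`, and every `Z ≥ Z̲`: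
IF the Gaussian bound with constants `(Q, 2Z)` holds at all times `t' ∈ (s, (s+t)/2]` at
`H_m`-centres (hypothesis (7.14)), THEN for all `x, y₁, y₂`

  `K(x,t;y₁,s) K(x,t;y₂,s) ≤ α Z (t−s)^{-m} e^{−2𝒩*_s(x,t)} exp(−d_s²(y₁,y₂)/((8+ε/2)(t−s)))`.

Proof: §7.3 of the source at general scale, by contradiction — Thm. 7.1,
the entropy comparison (7.19) at an `H_m`-centre `(z', t_θ)`, the splitting (7.20), Hein–Naber
(7.21) with near-minimizers `v_i`, the hypothesis at `(v_i, t_θ)` with `H_m`-centres `z_i` (7.23),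
the distance bookkeeping (7.25) through `IsHCenter.edist_le_edist_add`, and the exponent estimate
(7.26); logarithms replace the real powers `(·)^{1+β}` of the source.
[cite: Bamler2020Entropy, §7.3, Lemma 7.x (arXiv v1 Lemma 28), (7.17)–(7.26)] -/
theorem gaussianLemma_alpha (m : ℕ) (hm : 3 ≤ m) {Λ ε Q α : ℝ} (hΛ : 0 ≤ Λ) (hε : 0 < ε)
    (hQ : 0 < Q) (hα : 0 < α) :
    ∃ Zbar : ℝ, 0 < Zbar ∧ ∀ {M : Type*} [TopologicalSpace M]
      [ChartedSpace (EuclideanSpace ℝ (Fin m)) M]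
      [IsManifold 𝓘(ℝ, EuclideanSpace ℝ (Fin m)) ∞ M] [T2Space M] [CompactSpace M]
      [SecondCountableTopology M] [MeasurableSpace M] [BorelSpace M] [ConnectedSpace M] [T3Space M]
      {h : ℝ → PseudoRiemannianMetric 𝓘(ℝ, EuclideanSpace ℝ (Fin m)) ∞ (EuclideanSpace ℝ (Fin m))
        (TangentSpace 𝓘(ℝ, EuclideanSpace ℝ (Fin m)) : M → Type _)}
      {cov : ℝ → CovariantDerivative 𝓘(ℝ, EuclideanSpace ℝ (Fin m)) (EuclideanSpace ℝ (Fin m))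
        (TangentSpace 𝓘(ℝ, EuclideanSpace ℝ (Fin m)) : M → Type _)}
      {a T : ℝ} (hflow : IsRicciFlow h cov (Icc a T)) (hh : IsContMDiffFamilyOn ∞ h univ)
      (hR : ∀ r, (h r).IsRiemannian),
      ∀ {s t : ℝ}, a < s → s < t → t < T → ∀ {Rmin : ℝ},
      (∀ r ∈ Icc s t, ∀ z : M, Rmin ≤ (h r).scalarCurvatureWith (cov r) z) →
      -Rmin * (t - s) ≤ Λ → ∀ {Z : ℝ}, Zbar ≤ Z →
      (∀ t' ∈ Ioc s ((s + t) / 2), ∀ x' y' z' : M,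
        ∫⁻ w, (h s).edist (hR s) z' w ^ 2 ∂(heatKernelMeasure hh hR t' x' s) ≤
          ENNReal.ofReal ((((m : ℝ) - 1) * Real.pi ^ 2 / 2 + 4) * (t' - s)) →
        hflow.heatKernelFn hh hR t' x' (y', s) ≤
          2 * Z * (t' - s) ^ (-(m : ℝ) / 2) *
            Real.exp (-(pointedNashEntropy h (fun r v ↦ hflow.heatKernelFn hh hR t' x' (v, r)) m t' s)) *
            Real.exp (-((h s).edist (hR s) z' y').toReal ^ 2 / (Q * (t' - s)))) →
      ∀ x y₁ y₂ : M,
      hflow.heatKernelFn hh hR t x (y₁, s) * hflow.heatKernelFn hh hR t x (y₂, s) ≤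
        α * Z * (t - s) ^ (-(m : ℝ)) *
          Real.exp (-2 * pointedNashEntropy h (fun r v ↦ hflow.heatKernelFn hh hR t x (v, r)) m t s) *
          Real.exp (-((h s).edist (hR s) y₁ y₂).toReal ^ 2 / ((8 + ε / 2) * (t - s))) := by
  classical
  /- ── universal constants ── -/
  set Hm : ℝ := ((m : ℝ) - 1) * Real.pi ^ 2 / 2 + 4 with hHm
  have hm0 : 0 < m := by omega
  have hm1 : (1 : ℝ) ≤ m := by exact_mod_cast hm0
  have hHm0 : 0 < Hm := by
    have : 0 ≤ ((m : ℝ) - 1) * Real.pi ^ 2 / 2 := by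
      have := Real.pi_pos; positivity
    rw [hHm]; linarith
  obtain ⟨C₇, hC₇, H7⟩ := exists_heatKernelFn_le_rpow_mul_exp_neg_kernelNashEntropy m hm hΛ
  have hmΛ : 0 < (m : ℝ) / 2 + Λ := by positivity
  set c₁ : ℝ := Real.sqrt ((m : ℝ) / 2 + Λ) with hc₁
  have hc₁0 : 0 ≤ c₁ := Real.sqrt_nonneg _
  set c₂ : ℝ := c₁ * Real.sqrt Hm with hc₂
  have hc₂0 : 0 ≤ c₂ := by positivity
  -- `β = β(ε)` with `(1 + β)³ ≤ (8 + ε/2)/8`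
  set β : ℝ := min (1 / 2) (ε / 112) with hβ
  have hβ0 : 0 < β := by rw [hβ]; exact lt_min (by norm_num) (by positivity)
  have hβhalf : β ≤ 1 / 2 := min_le_left _ _
  have hβε : β ≤ ε / 112 := min_le_right _ _
  have hβ1 : β ≤ 1 := hβhalf.trans (by norm_num)
  have h1β : 0 < 1 - β := by linarith
  have hcoef1 : (1 + β) ^ 3 / (8 + ε / 2) ≤ 1 / 8 := by
    rw [div_le_iff₀ (by positivity)]
    have := one_add_pow_three_le hβ0.le hβ1
    linarith
  -- `θ = θ(m, Λ, ε, Q) ≤ 1/2`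
  set θ : ℝ := min (1 / 2) (β ^ 2 * (8 + ε / 2) / (3 * Q * (1 + β) ^ 3)) with hθ
  have hθ0 : 0 < θ := by rw [hθ]; exact lt_min (by norm_num) (by positivity)
  have hθhalf : θ ≤ 1 / 2 := min_le_left _ _
  have hθ1 : θ ≤ 1 := hθhalf.trans (by norm_num)
  have hcoef2 : 3 * (1 + β) ^ 3 / (β * (8 + ε / 2)) ≤ β / (Q * θ) := by
    have hθle : θ ≤ β ^ 2 * (8 + ε / 2) / (3 * Q * (1 + β) ^ 3) := min_le_right _ _
    rw [div_le_div_iff₀ (by positivity) (by positivity)]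
    have h1' : θ * (3 * Q * (1 + β) ^ 3) ≤ β ^ 2 * (8 + ε / 2) :=
      (le_div_iff₀ (by positivity)).1 hθle
    nlinarith [h1']
  have hθpow0 : 0 < θ ^ (-(m : ℝ) / 2) := Real.rpow_pos_of_pos hθ0 _
  have hθinv0 : 0 < θ ^ (-(1 : ℝ) / 2) := Real.rpow_pos_of_pos hθ0 _
  -- derived constants
  set k₁ : ℝ := C₇ * θ ^ (-(m : ℝ) / 2) * Real.exp (c₂ * θ ^ (-(1 : ℝ) / 2)) with hk₁
  have hk₁0 : 0 < k₁ := by positivity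
  set k₂ : ℝ := θ ^ (-(m : ℝ) / 2) * Real.exp (c₂ * θ ^ (-(1 : ℝ) / 2)) with hk₂
  have hk₂0 : 0 < k₂ := by positivity
  set c₃ : ℝ := 2 * Real.exp (25 * c₁ ^ 2 / θ + 2 * Hm) * (1 + c₁ * θ ^ (-(1 : ℝ) / 2)) with hc₃
  have hc₃0 : 0 < c₃ := by positivity
  set c₅ : ℝ := 2 * c₃ * Real.exp (25 * c₁ ^ 2 / θ) + c₃ ^ 2 with hc₅
  have hc₅0 : 0 < c₅ := by positivity
  set bq : ℝ := 20 * (1 + β) * c₁ * θ ^ (-(1 : ℝ) / 2) with hbq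
  set cq : ℝ := β * (1 + β) / (8 + ε / 2) with hcq
  have hcq0 : 0 < cq := by positivity
  set k₄ : ℝ := bq ^ 2 / (4 * cq) + 12 * Hm * θ * (1 + β) ^ 3 / (β * (8 + ε / 2)) with hk₄
  set k₅ : ℝ := Real.log (8 * Real.exp (1 / 2) * k₁ ^ 2) + β * Real.log (16 * k₂ ^ 2) -
    (1 + β) * Real.log α + k₄ with hk₅
  set Z₁ : ℝ := C₇ ^ 2 * Real.exp (1 / 8) / α with hZ₁
  set Z₃ : ℝ := 8 * k₁ ^ 2 * c₅ / α with hZ₃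
  set Z₄ : ℝ := Real.exp (k₅ / (1 - β)) with hZ₄
  have hZ₄0 : 0 < Z₄ := Real.exp_pos _
  set Zbar : ℝ := max (max Z₁ Z₃) Z₄ + 1 with hZbar
  have hZbar0 : 0 < Zbar := by
    have : Z₄ ≤ max (max Z₁ Z₃) Z₄ := le_max_right _ _
    linarith
  refine ⟨Zbar, hZbar0, ?_⟩
  intro M _ _ _ _ _ _ _ _ _ _ h cov a T hflow hh hR s t has hst htT Rmin hRmin hRΛ Z hZ HYP x y₁ y₂
  have hZ1 : Z₁ < Z := by
    have : Z₁ ≤ max (max Z₁ Z₃) Z₄ := (le_max_left _ _).trans (le_max_left _ _)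
    linarith
  have hZ3 : Z₃ < Z := by
    have : Z₃ ≤ max (max Z₁ Z₃) Z₄ := (le_max_right _ _).trans (le_max_left _ _)
    linarith
  have hZ4 : Z₄ < Z := by
    have : Z₄ ≤ max (max Z₁ Z₃) Z₄ := le_max_right _ _
    linarith
  have hZpos : 0 < Z := hZ₄0.trans hZ4
  by_contra hcon
  rw [not_le] at hcon
  /- ── times, kernel values, the normalisation `P = τ^{-m/2} e^{-N}` ── -/
  set τ : ℝ := t - s with hτdef
  have hτ : 0 < τ := sub_pos.2 hst
  have hsτ : 0 < Real.sqrt τ := Real.sqrt_pos.2 hτ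
  have ht : t ∈ Ioc a T := ⟨has.trans hst, htT.le⟩
  set N : ℝ := pointedNashEntropy h (fun r v ↦ hflow.heatKernelFn hh hR t x (v, r)) m t s with hN
  have hτpow : 0 < τ ^ (-(m : ℝ) / 2) := Real.rpow_pos_of_pos hτ _
  set P : ℝ := τ ^ (-(m : ℝ) / 2) * Real.exp (-N) with hP
  have hP0 : 0 < P := mul_pos hτpow (Real.exp_pos _)
  set a₁ : ℝ := hflow.heatKernelFn hh hR t x (y₁, s) with ha₁
  set a₂ : ℝ := hflow.heatKernelFn hh hR t x (y₂, s) with ha₂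
  have ha₁pos : 0 < a₁ := hflow.heatKernelFn_pos hh hR ht x ⟨mem_univ _, has, hst⟩
  have ha₂pos : 0 < a₂ := hflow.heatKernelFn_pos hh hR ht x ⟨mem_univ _, has, hst⟩
  have hdfin : (h s).edist (hR s) y₁ y₂ ≠ ⊤ := PseudoRiemannianMetric.edist_ne_top (hR s) y₁ y₂
  set d : ℝ := ((h s).edist (hR s) y₁ y₂).toReal with hd
  have hd0 : 0 ≤ d := ENNReal.toReal_nonneg
  set G : ℝ := Real.exp (-d ^ 2 / ((8 + ε / 2) * τ)) with hG
  have hG0 : 0 < G := Real.exp_pos _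
  have hG1 : G ≤ 1 := by
    rw [hG, Real.exp_le_one_iff, neg_div]
    exact neg_nonpos.2 (div_nonneg (sq_nonneg _) (mul_pos (by linarith only [hε]) hτ).le)
  -- the contradiction hypothesis, normalised
  have hcon' : α * Z * P ^ 2 * G < a₁ * a₂ := by
    have e : α * Z * τ ^ (-(m : ℝ)) * Real.exp (-2 * N) * G = α * Z * P ^ 2 * G := by
      have e1 : τ ^ (-(m : ℝ)) = (τ ^ (-(m : ℝ) / 2)) ^ 2 := by
        rw [← Real.rpow_natCast (τ ^ (-(m : ℝ) / 2)) 2, ← Real.rpow_mul hτ.le]; norm_num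
      have e2 : Real.exp (-2 * N) = Real.exp (-N) ^ 2 := by
        rw [sq, ← Real.exp_add]; ring_nf
      rw [hP, e1, e2]; ring
    rw [← e]
    exact hcon
  /- ── Thm. 7.1 on `[s, t]`: `a_i ≤ C₇ P` ── -/
  have ha₁7 : a₁ ≤ C₇ * P := by
    have h' := H7 hflow hh hR has hst htT hRmin hRΛ x y₁
    calc a₁ = hflow.heatKernelFn hh hR t x (y₁, s) := rfl
      _ ≤ C₇ * (t - s) ^ (-(m : ℝ) / 2) * Real.exp (-N) := h'
      _ = C₇ * P := by rw [hP, hτdef]; ring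
  have ha₂7 : a₂ ≤ C₇ * P := by
    have h' := H7 hflow hh hR has hst htT hRmin hRΛ x y₂
    calc a₂ = hflow.heatKernelFn hh hR t x (y₂, s) := rfl
      _ ≤ C₇ * (t - s) ^ (-(m : ℝ) / 2) * Real.exp (-N) := h'
      _ = C₇ * P := by rw [hP, hτdef]; ring
  have ha₁a₂ : a₁ * a₂ ≤ C₇ ^ 2 * P ^ 2 := by
    calc a₁ * a₂ ≤ (C₇ * P) * (C₇ * P) := mul_le_mul ha₁7 ha₂7 ha₂pos.le (mul_pos hC₇ hP0).le
      _ = C₇ ^ 2 * P ^ 2 := by ring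
  /- ── case `d < √τ`: the trivial bound contradicts `Z ≥ Z₁` ── -/
  rcases lt_or_ge d (Real.sqrt τ) with hdsmall | hdlarge
  · have hden : 0 < (8 + ε / 2) * τ := mul_pos (by linarith only [hε]) hτ
    have hGlow : Real.exp (-(1 / 8 : ℝ)) < G := by
      rw [hG, Real.exp_lt_exp]
      have hd2 : d ^ 2 < τ := by
        calc d ^ 2 < Real.sqrt τ ^ 2 := pow_lt_pow_left₀ hdsmall hd0 (by norm_num)
          _ = τ := Real.sq_sqrt hτ.le
      have h8 : d ^ 2 / ((8 + ε / 2) * τ) < 1 / 8 := by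
        rw [div_lt_iff₀ hden]
        nlinarith only [hd2, hε, hτ]
      have e : -d ^ 2 / ((8 + ε / 2) * τ) = -(d ^ 2 / ((8 + ε / 2) * τ)) := neg_div _ _
      linarith only [h8, e]
    -- `α Z P² e^{-1/8} < α Z P² G < a₁ a₂ ≤ C₇² P²` ⇒ `Z < Z₁`
    have hαZP : 0 < α * Z * P ^ 2 := mul_pos (mul_pos hα hZpos) (pow_pos hP0 2)
    have h1' : α * Z * P ^ 2 * Real.exp (-(1 / 8 : ℝ)) < C₇ ^ 2 * P ^ 2 :=
      ((mul_lt_mul_of_pos_left hGlow hαZP).trans hcon').trans_le ha₁a₂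
    have h2' : α * Z * Real.exp (-(1 / 8 : ℝ)) < C₇ ^ 2 := by
      have e : α * Z * P ^ 2 * Real.exp (-(1 / 8 : ℝ)) =
          (α * Z * Real.exp (-(1 / 8 : ℝ))) * P ^ 2 := by ring
      rw [e] at h1'
      exact lt_of_mul_lt_mul_right h1' (pow_pos hP0 2).le
    have h3' : Z < Z₁ := by
      rw [hZ₁, lt_div_iff₀ hα]
      have e8 : Real.exp (-(1 / 8 : ℝ)) * Real.exp (1 / 8 : ℝ) = 1 := by
        rw [← Real.exp_add]; norm_num
      calc Z * α = (α * Z * Real.exp (-(1 / 8 : ℝ))) * Real.exp (1 / 8 : ℝ) := by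
            rw [mul_assoc (α * Z), e8, mul_one, mul_comm]
        _ < C₇ ^ 2 * Real.exp (1 / 8 : ℝ) := mul_lt_mul_of_pos_right h2' (Real.exp_pos _)
    exact absurd h3' (not_lt.2 hZ1.le)
  /- ── main case `√τ ≤ d` ── -/
  have hdpos : 0 < d := hsτ.trans_le hdlarge
  -- the intermediate time `t_θ = s + θ τ` and `σ = t − t_θ = (1 − θ) τ`
  set tθ : ℝ := s + θ * τ with htθdef
  have hθτ : 0 < θ * τ := mul_pos hθ0 hτ
  have hsθ : s < tθ := by rw [htθdef]; linarith only [hθτ]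
  have htθs : tθ - s = θ * τ := by rw [htθdef]; ring
  have hθτle : θ * τ ≤ τ / 2 := by nlinarith only [hθhalf, hτ]
  have hθt : tθ < t := by
    have : tθ ≤ s + τ / 2 := by rw [htθdef]; linarith only [hθτle]
    have e : t = s + τ := by rw [hτdef]; ring
    rw [e]; linarith only [this, hτ]
  have haθ : a < tθ := has.trans hsθ
  have hθmem : tθ ∈ Ioc s ((s + t) / 2) := by
    refine ⟨hsθ, ?_⟩
    have e : (s + t) / 2 = s + τ / 2 := by rw [hτdef]; ring
    rw [e, htθdef]; linarith only [hθτle]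
  set σ : ℝ := t - tθ with hσdef
  have hσ : 0 < σ := sub_pos.2 hθt
  have hσeq : σ = (1 - θ) * τ := by rw [hσdef, htθdef, hτdef]; ring
  have hστ : σ ≤ τ := by
    rw [hσeq]; nlinarith only [hθ0, hτ]
  have hτσ : τ / 2 ≤ σ := by
    rw [hσeq]; nlinarith only [hθhalf, hτ]
  have htθI : tθ ∈ Icc a T := ⟨haθ.le, (hθt.trans htT).le⟩
  have htI : t ∈ Icc a T := ⟨(has.trans hst).le, htT.le⟩
  have htθT : tθ ∈ Ioc a T := ⟨haθ, (hθt.trans htT).le⟩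
  -- the `H_m`-centre `z'` of `(x, t)` at time `t_θ` (kernel form)
  obtain ⟨z', hvar'⟩ := hflow.exists_lintegral_edist_sq_heatKernelMeasure_le hh hR hm0 htθI htI hθt.le x
  /- ── the entropy comparison (7.19): `e^{-𝒩*_s(w,t_θ)} ≤ e^{-N} e^{c₂ θ^{-1/2}} e^{κ d_θ(z',w)}` ── -/
  set κ : ℝ := c₁ * θ ^ (-(1 : ℝ) / 2) / Real.sqrt τ with hκ
  have hκ0 : 0 ≤ κ := div_nonneg (mul_nonneg hc₁0 hθinv0.le) hsτ.le
  have hRs : ∀ z : M, Rmin ≤ (h s).scalarCurvatureWith (cov s) z := hRmin s ⟨le_rfl, hst.le⟩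
  set Lθ : ℝ := Real.sqrt ((m : ℝ) / (2 * (tθ - s)) - Rmin) with hLθ
  have hLθ0 : 0 ≤ Lθ := Real.sqrt_nonneg _
  have hθsqrt : θ ^ (-(1 : ℝ) / 2) = (Real.sqrt θ)⁻¹ := by
    rw [Real.sqrt_eq_rpow, ← Real.rpow_neg hθ0.le]; norm_num
  have hsθ0 : 0 < Real.sqrt θ := Real.sqrt_pos.2 hθ0
  -- `Lθ √τ ≤ c₁ θ^{-1/2}`
  have hLθτ : Lθ * Real.sqrt τ ≤ c₁ * θ ^ (-(1 : ℝ) / 2) := by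
    have hRmτ : -Rmin ≤ Λ / τ := by rw [le_div_iff₀ hτ]; exact hRΛ
    have hkey : (m : ℝ) / (2 * (tθ - s)) - Rmin ≤ ((m : ℝ) / 2 + Λ) / θ / τ := by
      rw [htθs]
      have e1 : (m : ℝ) / (2 * (θ * τ)) = (m : ℝ) / 2 / θ / τ := by
        field_simp
      have e2 : ((m : ℝ) / 2 + Λ) / θ / τ = (m : ℝ) / 2 / θ / τ + Λ / θ / τ := by ring
      rw [e1, e2]
      have hΛθ : Λ / τ ≤ Λ / θ / τ := by
        refine div_le_div_of_nonneg_right ?_ hτ.le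
        rw [le_div_iff₀ hθ0]
        nlinarith only [hΛ, hθ1]
      linarith only [hRmτ, hΛθ]
    have h1' := sqrt_mul_sqrt_le_sqrt_of_le_div hτ hkey
    rw [hLθ]
    refine h1'.trans (le_of_eq ?_)
    rw [Real.sqrt_div' _ hθ0.le, hθsqrt, hc₁, div_eq_mul_inv]
  have hcmp : ∀ w : M,
      Real.exp (-(pointedNashEntropy h (fun r v ↦ hflow.heatKernelFn hh hR tθ w (v, r)) m tθ s)) ≤
        Real.exp (-N) * Real.exp (c₂ * θ ^ (-(1 : ℝ) / 2)) *
          Real.exp (κ * ((h tθ).edist (hR tθ) z' w).toReal) := by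
    intro w
    have hV0 : 0 ≤ Hm * (t - tθ) := mul_nonneg hHm0.le hσ.le
    have hec := kernelNashEntropy_sub_le_of_lintegral_edist_sq_le hflow hh hR hm has hsθ hθt.le htT
      hRs x z' hV0 hvar' w
    -- `Lθ √(Hm σ) ≤ c₂ θ^{-1/2}` and `Lθ dd ≤ κ dd`
    have hdd0 : 0 ≤ ((h tθ).edist (hR tθ) z' w).toReal := ENNReal.toReal_nonneg
    have hsqV : Real.sqrt (Hm * (t - tθ)) ≤ Real.sqrt τ * Real.sqrt Hm := by
      rw [← Real.sqrt_mul hτ.le]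
      exact Real.sqrt_le_sqrt (by nlinarith only [hστ, hHm0, hσdef])
    have hA : Lθ * Real.sqrt (Hm * (t - tθ)) ≤ c₂ * θ ^ (-(1 : ℝ) / 2) := by
      calc Lθ * Real.sqrt (Hm * (t - tθ)) ≤ Lθ * (Real.sqrt τ * Real.sqrt Hm) :=
            mul_le_mul_of_nonneg_left hsqV hLθ0
        _ = (Lθ * Real.sqrt τ) * Real.sqrt Hm := by ring
        _ ≤ (c₁ * θ ^ (-(1 : ℝ) / 2)) * Real.sqrt Hm :=
            mul_le_mul_of_nonneg_right hLθτ (Real.sqrt_nonneg _)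
        _ = c₂ * θ ^ (-(1 : ℝ) / 2) := by rw [hc₂]; ring
    have hB : Lθ * ((h tθ).edist (hR tθ) z' w).toReal ≤ κ * ((h tθ).edist (hR tθ) z' w).toReal := by
      refine mul_le_mul_of_nonneg_right ?_ hdd0
      rw [hκ, le_div_iff₀ hsτ]
      exact hLθτ
    rw [← Real.exp_add, ← Real.exp_add, Real.exp_le_exp]
    have hec' : N - pointedNashEntropy h (fun r v ↦ hflow.heatKernelFn hh hR tθ w (v, r)) m tθ s ≤
        Lθ * Real.sqrt (Hm * (t - tθ)) + Lθ * ((h tθ).edist (hR tθ) z' w).toReal := by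
      rw [← mul_add]; exact hec
    linarith only [hec', hA, hB]
  /- ── the pointwise majorant of `u_i = K(·,t_θ;y_i,s)`: Thm. 7.1 on `[s, t_θ]` + (7.19) ── -/
  have hRmin' : ∀ r ∈ Icc s tθ, ∀ z : M, Rmin ≤ (h r).scalarCurvatureWith (cov r) z :=
    fun r hr z ↦ hRmin r ⟨hr.1, hr.2.trans hθt.le⟩ z
  have hRΛ' : -Rmin * (tθ - s) ≤ Λ := by
    rw [htθs]
    rcases le_or_gt 0 Rmin with h0 | h0
    · have : -Rmin * (θ * τ) ≤ 0 := by nlinarith only [h0, hθτ]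
      linarith only [this, hΛ]
    · have h1' : 0 ≤ τ - θ * τ := by nlinarith only [hθ1, hτ]
      have : -Rmin * (θ * τ) ≤ -Rmin * τ := by nlinarith only [h0, h1']
      linarith only [this, hRΛ]
  have hθτpow : (θ * τ) ^ (-(m : ℝ) / 2) = θ ^ (-(m : ℝ) / 2) * τ ^ (-(m : ℝ) / 2) :=
    Real.mul_rpow hθ0.le hτ.le
  have hA₀eq : C₇ * (tθ - s) ^ (-(m : ℝ) / 2) * (Real.exp (-N) * Real.exp (c₂ * θ ^ (-(1 : ℝ) / 2))) =
      k₁ * P := by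
    rw [htθs, hθτpow, hk₁, hP]; ring
  have hmaj : ∀ (yy : M) (w : M), hflow.heatKernelFn hh hR tθ w (yy, s) ≤
      (k₁ * P) * Real.exp (κ * ((h tθ).edist (hR tθ) z' w).toReal) := by
    intro yy w
    have h71 := H7 hflow hh hR has hsθ (hθt.trans htT) hRmin' hRΛ' w yy
    have hpow0 : 0 ≤ C₇ * (tθ - s) ^ (-(m : ℝ) / 2) :=
      mul_nonneg hC₇.le (Real.rpow_nonneg (by rw [htθs]; exact hθτ.le) _)
    calc hflow.heatKernelFn hh hR tθ w (yy, s)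
        ≤ C₇ * (tθ - s) ^ (-(m : ℝ) / 2) *
          Real.exp (-(pointedNashEntropy h (fun r v ↦ hflow.heatKernelFn hh hR tθ w (v, r)) m tθ s)) :=
          h71
      _ ≤ C₇ * (tθ - s) ^ (-(m : ℝ) / 2) * (Real.exp (-N) * Real.exp (c₂ * θ ^ (-(1 : ℝ) / 2)) *
          Real.exp (κ * ((h tθ).edist (hR tθ) z' w).toReal)) :=
          mul_le_mul_of_nonneg_left (hcmp w) hpow0
      _ = (k₁ * P) * Real.exp (κ * ((h tθ).edist (hR tθ) z' w).toReal) := by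
          rw [← hA₀eq]; ring
  /- ── the splitting (7.20) for `a₁`, `a₂` ── -/
  set νθ : Measure M := heatKernelMeasure hh hR t x tθ with hνθ
  haveI : IsProbabilityMeasure νθ := by rw [hνθ]; infer_instance
  set B' : Set M := {w | (h tθ).edist (hR tθ) z' w < ENNReal.ofReal (10 * d)} with hB'
  set V₁ : Set M := {w | a₁ ≤ 2 * hflow.heatKernelFn hh hR tθ w (y₁, s)} with hV₁
  set V₂ : Set M := {w | a₂ ≤ 2 * hflow.heatKernelFn hh hR tθ w (y₂, s)} with hV₂
  set ν₁ : ℝ := νθ.real (V₁ ∩ B') with hν₁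
  set ν₂ : ℝ := νθ.real (V₂ ∩ B') with hν₂
  have hν₁0 : 0 ≤ ν₁ := measureReal_nonneg
  have hν₂0 : 0 ≤ ν₂ := measureReal_nonneg
  have hν₁1 : ν₁ ≤ 1 := measureReal_le_one
  have hν₂1 : ν₂ ≤ 1 := measureReal_le_one
  have hR₀ : 0 < 10 * d := by linarith only [hdpos]
  have hkP0 : 0 ≤ k₁ * P := (mul_pos hk₁0 hP0).le
  set Tail : ℝ := 2 * Real.exp (25 * κ ^ 2 * (t - tθ) + 2 * Hm) *
      (1 + 10 * κ * (t - tθ) / (10 * d)) * Real.exp (-(10 * d) ^ 2 / (10 * (t - tθ))) with hTail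
  have hE₁ : a₁ ≤ 2 * (k₁ * P) * (Real.exp (κ * (10 * d)) * ν₁ + Tail) :=
    heatKernelFn_le_of_forall_le_exp_mul_edist hflow hh hR has hsθ hθt htT.le x y₁ z' hvar' hkP0 hκ0
      hR₀ (hmaj y₁)
  have hE₂ : a₂ ≤ 2 * (k₁ * P) * (Real.exp (κ * (10 * d)) * ν₂ + Tail) :=
    heatKernelFn_le_of_forall_le_exp_mul_edist hflow hh hR has hsθ hθt htT.le x y₂ z' hvar' hkP0 hκ0
      hR₀ (hmaj y₂)
  -- the tail is `≤ c₃ e^{-10 d²/τ}`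
  have hκsqτ : κ ^ 2 * τ = c₁ ^ 2 / θ := by
    rw [hκ, div_pow, mul_pow, Real.sq_sqrt hτ.le, hθsqrt, inv_pow, Real.sq_sqrt hθ0.le]
    field_simp
  have hκτd : κ * τ / d ≤ c₁ * θ ^ (-(1 : ℝ) / 2) := by
    rw [div_le_iff₀ hdpos, hκ]
    have e : c₁ * θ ^ (-(1 : ℝ) / 2) / Real.sqrt τ * τ = (c₁ * θ ^ (-(1 : ℝ) / 2)) * Real.sqrt τ := by
      rw [div_mul_eq_mul_div, mul_div_assoc]
      congr 1
      rw [div_eq_iff hsτ.ne', ← sq, Real.sq_sqrt hτ.le]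
    rw [e]
    exact mul_le_mul_of_nonneg_left hdlarge (mul_nonneg hc₁0 hθinv0.le)
  have hTail : Tail ≤ c₃ * Real.exp (-(10 * d ^ 2 / τ)) := by
    have h1' : 25 * κ ^ 2 * (t - tθ) + 2 * Hm ≤ 25 * c₁ ^ 2 / θ + 2 * Hm := by
      have : κ ^ 2 * (t - tθ) ≤ κ ^ 2 * τ := mul_le_mul_of_nonneg_left hστ (sq_nonneg _)
      have e : 25 * c₁ ^ 2 / θ = 25 * (κ ^ 2 * τ) := by rw [hκsqτ]; ring
      linarith only [this, e]
    have h2' : 1 + 10 * κ * (t - tθ) / (10 * d) ≤ 1 + c₁ * θ ^ (-(1 : ℝ) / 2) := by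
      have e : 10 * κ * (t - tθ) / (10 * d) = κ * (t - tθ) / d := by
        field_simp
      rw [e]
      have : κ * (t - tθ) / d ≤ κ * τ / d :=
        div_le_div_of_nonneg_right (mul_le_mul_of_nonneg_left hστ hκ0) hd0
      linarith only [this, hκτd]
    have h3' : Real.exp (-(10 * d) ^ 2 / (10 * (t - tθ))) ≤ Real.exp (-(10 * d ^ 2 / τ)) := by
      rw [Real.exp_le_exp]
      have e : -(10 * d) ^ 2 / (10 * (t - tθ)) = -(10 * d ^ 2 / σ) := by
        rw [hσdef, show (10 * d) ^ 2 = 10 * (10 * d ^ 2) by ring, neg_div,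
          mul_div_mul_left _ _ (by norm_num : (10 : ℝ) ≠ 0)]
      rw [e, neg_le_neg_iff]
      exact div_le_div_of_nonneg_left (by nlinarith only [hdpos]) hσ hστ
    have hp1 : 0 ≤ 2 * Real.exp (25 * κ ^ 2 * (t - tθ) + 2 * Hm) := by
      have := Real.exp_pos (25 * κ ^ 2 * (t - tθ) + 2 * Hm); linarith only [this]
    have hp2 : 0 ≤ 1 + 10 * κ * (t - tθ) / (10 * d) := by
      have : 0 ≤ 10 * κ * (t - tθ) / (10 * d) :=
        div_nonneg (mul_nonneg (mul_nonneg (by norm_num) hκ0) hσ.le) hR₀.le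
      linarith only [this]
    calc Tail = 2 * Real.exp (25 * κ ^ 2 * (t - tθ) + 2 * Hm) *
          (1 + 10 * κ * (t - tθ) / (10 * d)) * Real.exp (-(10 * d) ^ 2 / (10 * (t - tθ))) := rfl
      _ ≤ 2 * Real.exp (25 * c₁ ^ 2 / θ + 2 * Hm) * (1 + c₁ * θ ^ (-(1 : ℝ) / 2)) *
          Real.exp (-(10 * d ^ 2 / τ)) := by
          refine mul_le_mul (mul_le_mul ?_ h2' hp2 ?_) h3' (Real.exp_pos _).le ?_
          · exact mul_le_mul_of_nonneg_left (Real.exp_le_exp.2 h1') (by norm_num)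
          · have := Real.exp_pos (25 * c₁ ^ 2 / θ + 2 * Hm); linarith only [this]
          · exact mul_nonneg (by have := Real.exp_pos (25 * c₁ ^ 2 / θ + 2 * Hm); linarith only [this])
              (by linarith only [mul_nonneg hc₁0 hθinv0.le])
      _ = c₃ * Real.exp (-(10 * d ^ 2 / τ)) := by rw [hc₃]
  /- ── absorption of the error terms: (7.21)–(7.22) ── -/
  set E : ℝ := Real.exp (κ * (10 * d)) with hEdef
  have hE1 : 1 ≤ E := by
    rw [hEdef]; exact Real.one_le_exp (mul_nonneg hκ0 hR₀.le)
  have hE0 : 0 < E := Real.exp_pos _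
  -- measurability / closedness facts about the sets, recorded before forgetting definitions
  have hu₁c : Continuous fun w ↦ hflow.heatKernelFn hh hR tθ w (y₁, s) :=
    hflow.continuous_heatKernelFn_basePoint_slice hh hR htθT ⟨has, hsθ⟩
  have hu₂c : Continuous fun w ↦ hflow.heatKernelFn hh hR tθ w (y₂, s) :=
    hflow.continuous_heatKernelFn_basePoint_slice hh hR htθT ⟨has, hsθ⟩
  have hdc : Continuous fun w ↦ (h tθ).edist (hR tθ) z' w :=
    ((h tθ).continuous_edist (hR tθ)).comp (.prodMk_right z')
  have hB'm : MeasurableSet B' := by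
    rw [hB']; exact measurableSet_lt hdc.measurable measurable_const
  have hV₁m : MeasurableSet V₁ := by
    rw [hV₁]; exact measurableSet_le measurable_const (hu₁c.measurable.const_mul 2)
  have hV₂m : MeasurableSet V₂ := by
    rw [hV₂]; exact measurableSet_le measurable_const (hu₂c.measurable.const_mul 2)
  -- forget the bodies of the heavy abbreviations (performance)
  clear_value E Tail ν₁ ν₂ νθ P N a₁ a₂
  -- `E e^{-10 d²/τ} ≤ e^{25 c₁²/θ} e^{-9 d²/τ}` and `e^{-9d²/τ} ≤ G`
  have hAMGM := ten_mul_kappa_mul_le (c₁ := c₁) (d := d) hθ0 hτ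
  have hEerr : E * Real.exp (-(10 * d ^ 2 / τ)) ≤
      Real.exp (25 * c₁ ^ 2 / θ) * Real.exp (-(9 * d ^ 2 / τ)) := by
    rw [hEdef, ← Real.exp_add, ← Real.exp_add, Real.exp_le_exp]
    have e : κ * (10 * d) = 10 * (c₁ * θ ^ (-(1 : ℝ) / 2) / Real.sqrt τ) * d := by rw [hκ]; ring
    rw [e]
    have e2 : -(10 * d ^ 2 / τ) = -(d ^ 2 / τ) - 9 * d ^ 2 / τ := by ring
    have e3 : -(9 * d ^ 2 / τ) = -(9 * d ^ 2) / τ := by ring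
    nlinarith only [hAMGM, e2]
  have h9G : Real.exp (-(9 * d ^ 2 / τ)) ≤ G := by
    rw [hG, Real.exp_le_exp]
    have hden : 0 < (8 + ε / 2) * τ := mul_pos (by linarith only [hε]) hτ
    have h1' : d ^ 2 / ((8 + ε / 2) * τ) ≤ 9 * d ^ 2 / τ := by
      rw [div_le_div_iff₀ hden hτ]
      have ha' : 0 ≤ d ^ 2 * τ := mul_nonneg (sq_nonneg d) hτ.le
      have hb' : 0 ≤ d ^ 2 * τ * ε := mul_nonneg ha' hε.le
      linarith only [ha', hb']
    have e : -d ^ 2 / ((8 + ε / 2) * τ) = -(d ^ 2 / ((8 + ε / 2) * τ)) := neg_div _ _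
    linarith only [h1', e]
  have herr : 2 * c₃ * (E * Real.exp (-(10 * d ^ 2 / τ))) + c₃ ^ 2 * Real.exp (-(20 * d ^ 2 / τ)) ≤
      c₅ * G := by
    have h20 : Real.exp (-(20 * d ^ 2 / τ)) ≤ Real.exp (-(9 * d ^ 2 / τ)) := by
      rw [Real.exp_le_exp, neg_le_neg_iff]
      exact div_le_div_of_nonneg_right (by nlinarith only [sq_nonneg d]) hτ.le
    have hG9 := h9G
    have hexp0 : 0 ≤ Real.exp (-(9 * d ^ 2 / τ)) := (Real.exp_pos _).le
    calc 2 * c₃ * (E * Real.exp (-(10 * d ^ 2 / τ))) + c₃ ^ 2 * Real.exp (-(20 * d ^ 2 / τ))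
        ≤ 2 * c₃ * (Real.exp (25 * c₁ ^ 2 / θ) * Real.exp (-(9 * d ^ 2 / τ))) +
          c₃ ^ 2 * Real.exp (-(9 * d ^ 2 / τ)) :=
          add_le_add (mul_le_mul_of_nonneg_left hEerr (by linarith only [hc₃0]))
            (mul_le_mul_of_nonneg_left h20 (sq_nonneg _))
      _ = c₅ * Real.exp (-(9 * d ^ 2 / τ)) := by rw [hc₅]; ring
      _ ≤ c₅ * G := mul_le_mul_of_nonneg_left hG9 hc₅0.le
  -- the product bound and the absorption, giving (★): `a₁ a₂ < 8 k₁² P² E² ν₁ ν₂`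
  have hprod : a₁ * a₂ ≤ 4 * k₁ ^ 2 * P ^ 2 * (E ^ 2 * (ν₁ * ν₂) +
      (2 * c₃ * (E * Real.exp (-(10 * d ^ 2 / τ))) + c₃ ^ 2 * Real.exp (-(20 * d ^ 2 / τ)))) := by
    have hT' : Tail ≤ c₃ * Real.exp (-(10 * d ^ 2 / τ)) := hTail
    have hx₁ : a₁ ≤ 2 * (k₁ * P) * (E * ν₁ + c₃ * Real.exp (-(10 * d ^ 2 / τ))) := by
      refine hE₁.trans (mul_le_mul_of_nonneg_left (by linarith only [hT']) (by linarith only [hkP0]))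
    have hx₂ : a₂ ≤ 2 * (k₁ * P) * (E * ν₂ + c₃ * Real.exp (-(10 * d ^ 2 / τ))) := by
      refine hE₂.trans (mul_le_mul_of_nonneg_left (by linarith only [hT']) (by linarith only [hkP0]))
    have hq0 : 0 ≤ E * ν₂ + c₃ * Real.exp (-(10 * d ^ 2 / τ)) :=
      add_nonneg (mul_nonneg hE0.le hν₂0) (mul_nonneg hc₃0.le (Real.exp_pos _).le)
    have hmul := mul_le_mul hx₁ hx₂ ha₂pos.le
      (mul_nonneg (by linarith only [hkP0]) (add_nonneg (mul_nonneg hE0.le hν₁0)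
        (mul_nonneg hc₃0.le (Real.exp_pos _).le)))
    refine hmul.trans ?_
    -- expand and use `ν_i ≤ 1` on the cross terms
    set X : ℝ := Real.exp (-(10 * d ^ 2 / τ)) with hX
    have hexp10 : 0 ≤ X := (Real.exp_pos _).le
    have hcross : E * ν₁ * (c₃ * X) + c₃ * X * (E * ν₂) ≤ 2 * c₃ * (E * X) := by
      have h1' : E * ν₁ ≤ E := by nlinarith only [hE0, hν₁1, hν₁0]
      have h2' : E * ν₂ ≤ E := by nlinarith only [hE0, hν₂1, hν₂0]
      have hc0 : 0 ≤ c₃ * X := mul_nonneg hc₃0.le hexp10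
      nlinarith only [h1', h2', hc0]
    have hsq : (c₃ * X) * (c₃ * X) = c₃ ^ 2 * Real.exp (-(20 * d ^ 2 / τ)) := by
      rw [hX, show -(20 * d ^ 2 / τ) = -(10 * d ^ 2 / τ) + -(10 * d ^ 2 / τ) by ring, Real.exp_add]
      ring
    have h44 : (0 : ℝ) ≤ 4 := by norm_num
    have hkk : 0 ≤ 4 * k₁ ^ 2 * P ^ 2 := mul_nonneg (mul_nonneg h44 (sq_nonneg k₁)) (sq_nonneg P)
    calc 2 * (k₁ * P) * (E * ν₁ + c₃ * X) * (2 * (k₁ * P) * (E * ν₂ + c₃ * X))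
        = 4 * k₁ ^ 2 * P ^ 2 * (E ^ 2 * (ν₁ * ν₂) +
            (E * ν₁ * (c₃ * X) + c₃ * X * (E * ν₂)) + (c₃ * X) * (c₃ * X)) := by ring
      _ ≤ 4 * k₁ ^ 2 * P ^ 2 * (E ^ 2 * (ν₁ * ν₂) +
            (2 * c₃ * (E * X) + c₃ ^ 2 * Real.exp (-(20 * d ^ 2 / τ)))) := by
          rw [hsq]
          refine mul_le_mul_of_nonneg_left ?_ hkk
          linarith only [hcross]
  have hstar : a₁ * a₂ < 8 * k₁ ^ 2 * P ^ 2 * E ^ 2 * (ν₁ * ν₂) := by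
    -- error ≤ 4 k₁² P² c₅ G ≤ α Z P² G / 2 < a₁ a₂ / 2
    have hZ3' : 8 * k₁ ^ 2 * c₅ ≤ α * Z := by
      have := hZ3.le
      rw [hZ₃, div_le_iff₀ hα] at this
      linarith only [this]
    have hP2 : 0 < P ^ 2 := pow_pos hP0 2
    have h44 : (0 : ℝ) ≤ 4 := by norm_num
    have hkk' : 0 ≤ 4 * k₁ ^ 2 * P ^ 2 := mul_nonneg (mul_nonneg h44 (sq_nonneg k₁)) (sq_nonneg P)
    have h1' : 4 * k₁ ^ 2 * P ^ 2 * (2 * c₃ * (E * Real.exp (-(10 * d ^ 2 / τ))) +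
        c₃ ^ 2 * Real.exp (-(20 * d ^ 2 / τ))) ≤ 4 * k₁ ^ 2 * P ^ 2 * (c₅ * G) :=
      mul_le_mul_of_nonneg_left herr hkk'
    have hPG : 0 ≤ P ^ 2 * G := mul_nonneg hP2.le hG0.le
    have h2'' : 8 * k₁ ^ 2 * c₅ * (P ^ 2 * G) ≤ α * Z * (P ^ 2 * G) :=
      mul_le_mul_of_nonneg_right hZ3' hPG
    -- `h1' : 4k₁²P²·err ≤ 4k₁²P²(c₅ G)`, `h2'' : 8k₁²c₅ (P²G) ≤ αZ (P²G)`
    have e0 : 4 * k₁ ^ 2 * P ^ 2 * (c₅ * G) = (8 * k₁ ^ 2 * c₅ * (P ^ 2 * G)) / 2 := by ring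
    have e0' : α * Z * (P ^ 2 * G) = α * Z * P ^ 2 * G := by ring
    have e : 4 * k₁ ^ 2 * P ^ 2 * (E ^ 2 * (ν₁ * ν₂) +
        (2 * c₃ * (E * Real.exp (-(10 * d ^ 2 / τ))) + c₃ ^ 2 * Real.exp (-(20 * d ^ 2 / τ)))) =
        4 * k₁ ^ 2 * P ^ 2 * (E ^ 2 * (ν₁ * ν₂)) + 4 * k₁ ^ 2 * P ^ 2 *
          (2 * c₃ * (E * Real.exp (-(10 * d ^ 2 / τ))) + c₃ ^ 2 * Real.exp (-(20 * d ^ 2 / τ))) := by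
      ring
    linarith only [hprod, h1', h2'', e0, e0', hcon', e]
  /- ── both sets have positive mass; Hein–Naber with near-minimisers `v₁, v₂` (7.22) ── -/
  have hνpos : 0 < ν₁ * ν₂ := by
    by_contra hle
    have hle' : ν₁ * ν₂ ≤ 0 := not_lt.1 hle
    have : 8 * k₁ ^ 2 * P ^ 2 * E ^ 2 * (ν₁ * ν₂) ≤ 0 :=
      mul_nonpos_of_nonneg_of_nonpos (by
        exact mul_nonneg (mul_nonneg (mul_nonneg (by norm_num) (sq_nonneg _)) (sq_nonneg _))
          (sq_nonneg _)) hle'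
    linarith only [hstar, this, mul_pos ha₁pos ha₂pos]
  have hν₁pos : 0 < ν₁ := by
    rcases eq_or_lt_of_le hν₁0 with h0 | h0
    · rw [← h0, zero_mul] at hνpos; exact absurd hνpos (lt_irrefl _)
    · exact h0
  have hν₂pos : 0 < ν₂ := by
    rcases eq_or_lt_of_le hν₂0 with h0 | h0
    · rw [← h0, mul_zero] at hνpos; exact absurd hνpos (lt_irrefl _)
    · exact h0
  have hne₁ : (V₁ ∩ B').Nonempty := by
    by_contra hem
    rw [Set.not_nonempty_iff_eq_empty] at hem
    have : ν₁ = 0 := by rw [hν₁, hem, measureReal_empty]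
    exact absurd this hν₁pos.ne'
  have hne₂ : (V₂ ∩ B').Nonempty := by
    by_contra hem
    rw [Set.not_nonempty_iff_eq_empty] at hem
    have : ν₂ = 0 := by rw [hν₂, hem, measureReal_empty]
    exact absurd this hν₂pos.ne'
  obtain ⟨v₁, hv₁, v₂, hv₂, hHN⟩ :=
    exists_mem_real_mul_real_le_exp_neg_edist_sq hflow hh hR haθ hθt htT.le x (hV₁m.inter hB'm)
      (hV₂m.inter hB'm) hne₁ hne₂
  rw [← hνθ, ← hν₁, ← hν₂] at hHN
  have hdvfin : (h tθ).edist (hR tθ) v₁ v₂ ≠ ⊤ := PseudoRiemannianMetric.edist_ne_top (hR tθ) v₁ v₂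
  set dv : ℝ := ((h tθ).edist (hR tθ) v₁ v₂).toReal with hdv
  have hdv0 : 0 ≤ dv := ENNReal.toReal_nonneg
  -- (I): `a₁ a₂ < 8 e^{1/2} k₁² P² E² e^{-dv²/(8σ)}`
  have hI : a₁ * a₂ < 8 * Real.exp (1 / 2) * k₁ ^ 2 * P ^ 2 * E ^ 2 *
      Real.exp (-dv ^ 2 / (8 * σ)) := by
    have h1' : 8 * k₁ ^ 2 * P ^ 2 * E ^ 2 * (ν₁ * ν₂) ≤
        8 * k₁ ^ 2 * P ^ 2 * E ^ 2 * (Real.exp (1 / 2) * Real.exp (-dv ^ 2 / (8 * σ))) :=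
      mul_le_mul_of_nonneg_left (by rw [hσdef]; exact hHN)
        (mul_nonneg (mul_nonneg (mul_nonneg (by norm_num) (sq_nonneg _)) (sq_nonneg _))
          (sq_nonneg _))
    have := hstar.trans_le h1'
    linarith only [this]
  /- ── `H_m`-centres `z_i` of `(v_i, t_θ)` at time `s`; the hypothesis at `(v_i, t_θ)` (7.23) ── -/
  have hconc := ricciFlowMetricFlow_isHConcentrated hm0 hh hR Set.ordConnected_Icc hflow
  have hsI : s ∈ Icc a T := ⟨has.le, (hst.trans htT).le⟩
  have hsθ' : ((⟨s, hsI⟩ : Icc a T) : ℝ) ≤ ((⟨tθ, htθI⟩ : Icc a T) : ℝ) := hsθ.le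
  obtain ⟨z₁, hz₁⟩ := hconc.exists_isHCenter (s := ⟨s, hsI⟩) (t := ⟨tθ, htθI⟩) hsθ' v₁
  obtain ⟨z₂, hz₂⟩ := hconc.exists_isHCenter (s := ⟨s, hsI⟩) (t := ⟨tθ, htθI⟩) hsθ' v₂
  have hcc : MetricFlow.concentrationConst m = Hm := by
    simp only [MetricFlow.concentrationConst, hHm]
  have hz₁' : ∫⁻ w, (h s).edist (hR s) z₁ w ^ 2 ∂(heatKernelMeasure hh hR tθ v₁ s) ≤
      ENNReal.ofReal (Hm * (tθ - s)) := by
    have h' : ∫⁻ w, (h s).edist (hR s) z₁ w ^ 2 ∂(heatKernelMeasure hh hR tθ v₁ s) ≤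
        ENNReal.ofReal (MetricFlow.concentrationConst m * (tθ - s)) := hz₁.lintegral_edist_sq_le
    rwa [hcc] at h'
  have hz₂' : ∫⁻ w, (h s).edist (hR s) z₂ w ^ 2 ∂(heatKernelMeasure hh hR tθ v₂ s) ≤
      ENNReal.ofReal (Hm * (tθ - s)) := by
    have h' : ∫⁻ w, (h s).edist (hR s) z₂ w ^ 2 ∂(heatKernelMeasure hh hR tθ v₂ s) ≤
        ENNReal.ofReal (MetricFlow.concentrationConst m * (tθ - s)) := hz₂.lintegral_edist_sq_le
    rwa [hcc] at h'
  set d₁ : ℝ := ((h s).edist (hR s) z₁ y₁).toReal with hd₁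
  set d₂ : ℝ := ((h s).edist (hR s) z₂ y₂).toReal with hd₂
  have hd₁0 : 0 ≤ d₁ := ENNReal.toReal_nonneg
  have hd₂0 : 0 ≤ d₂ := ENNReal.toReal_nonneg
  have hHYP₁ := HYP tθ hθmem v₁ y₁ z₁ hz₁'
  have hHYP₂ := HYP tθ hθmem v₂ y₂ z₂ hz₂'
  -- `v_i ∈ V_i`: `a_i ≤ 2 u_i(v_i)`; `v_i ∈ B'`: `e^{κ d_θ(z',v_i)} ≤ E`
  have hv₁V : a₁ ≤ 2 * hflow.heatKernelFn hh hR tθ v₁ (y₁, s) := by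
    have := hv₁.1; rw [hV₁] at this; exact this
  have hv₂V : a₂ ≤ 2 * hflow.heatKernelFn hh hR tθ v₂ (y₂, s) := by
    have := hv₂.1; rw [hV₂] at this; exact this
  have hEv : ∀ v ∈ B', Real.exp (κ * ((h tθ).edist (hR tθ) z' v).toReal) ≤ E := by
    intro v hv
    rw [hB'] at hv
    have hlt : ((h tθ).edist (hR tθ) z' v).toReal < 10 * d := ENNReal.toReal_lt_of_lt_ofReal hv
    rw [hEdef, Real.exp_le_exp]
    exact mul_le_mul_of_nonneg_left hlt.le hκ0
  have hk₂P : Z * (tθ - s) ^ (-(m : ℝ) / 2) * (Real.exp (-N) * Real.exp (c₂ * θ ^ (-(1 : ℝ) / 2))) =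
      Z * k₂ * P := by
    rw [htθs, hθτpow, hk₂, hP]; ring
  have hII₁ : a₁ ≤ 4 * Z * k₂ * P * E * Real.exp (-d₁ ^ 2 / (Q * (θ * τ))) := by
    have hu := hHYP₁
    rw [htθs] at hu
    rw [htθs] at hk₂P
    -- `u₁(v₁) ≤ 2Z (θτ)^{-m/2} e^{-𝒩*(v₁)} e^{-d₁²/(Qθτ)} ≤ 2Z (θτ)^{-m/2} e^{-N} e^{c₂θ^{-1/2}} E e^{...}`
    have hpos2 : 0 ≤ 2 * Z * (θ * τ) ^ (-(m : ℝ) / 2) :=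
      mul_nonneg (mul_nonneg zero_le_two hZpos.le) (Real.rpow_nonneg hθτ.le _)
    have hstep : hflow.heatKernelFn hh hR tθ v₁ (y₁, s) ≤
        2 * Z * (θ * τ) ^ (-(m : ℝ) / 2) * (Real.exp (-N) * Real.exp (c₂ * θ ^ (-(1 : ℝ) / 2)) * E) *
          Real.exp (-d₁ ^ 2 / (Q * (θ * τ))) := by
      refine hu.trans ?_
      refine mul_le_mul_of_nonneg_right (mul_le_mul_of_nonneg_left ?_ hpos2) (Real.exp_pos _).le
      exact (hcmp v₁).trans (mul_le_mul_of_nonneg_left (hEv v₁ hv₁.2)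
        (mul_nonneg (Real.exp_pos _).le (Real.exp_pos _).le))
    have e : 2 * (2 * Z * (θ * τ) ^ (-(m : ℝ) / 2) *
        (Real.exp (-N) * Real.exp (c₂ * θ ^ (-(1 : ℝ) / 2)) * E) * Real.exp (-d₁ ^ 2 / (Q * (θ * τ)))) =
        4 * Z * k₂ * P * E * Real.exp (-d₁ ^ 2 / (Q * (θ * τ))) := by
      calc _ = 4 * (Z * (θ * τ) ^ (-(m : ℝ) / 2) * (Real.exp (-N) * Real.exp (c₂ * θ ^ (-(1 : ℝ) / 2)))) *
            E * Real.exp (-d₁ ^ 2 / (Q * (θ * τ))) := by ring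
        _ = 4 * (Z * k₂ * P) * E * Real.exp (-d₁ ^ 2 / (Q * (θ * τ))) := by rw [hk₂P]
        _ = _ := by ring
    calc a₁ ≤ 2 * hflow.heatKernelFn hh hR tθ v₁ (y₁, s) := hv₁V
      _ ≤ 2 * (2 * Z * (θ * τ) ^ (-(m : ℝ) / 2) *
          (Real.exp (-N) * Real.exp (c₂ * θ ^ (-(1 : ℝ) / 2)) * E) * Real.exp (-d₁ ^ 2 / (Q * (θ * τ)))) :=
          mul_le_mul_of_nonneg_left hstep zero_le_two
      _ = _ := e
  have hII₂ : a₂ ≤ 4 * Z * k₂ * P * E * Real.exp (-d₂ ^ 2 / (Q * (θ * τ))) := by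
    have hu := hHYP₂
    rw [htθs] at hu
    have hk₂P' : Z * (θ * τ) ^ (-(m : ℝ) / 2) * (Real.exp (-N) * Real.exp (c₂ * θ ^ (-(1 : ℝ) / 2))) =
        Z * k₂ * P := by rw [hθτpow, hk₂, hP]; ring
    have hpos2 : 0 ≤ 2 * Z * (θ * τ) ^ (-(m : ℝ) / 2) :=
      mul_nonneg (mul_nonneg zero_le_two hZpos.le) (Real.rpow_nonneg hθτ.le _)
    have hstep : hflow.heatKernelFn hh hR tθ v₂ (y₂, s) ≤
        2 * Z * (θ * τ) ^ (-(m : ℝ) / 2) * (Real.exp (-N) * Real.exp (c₂ * θ ^ (-(1 : ℝ) / 2)) * E) *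
          Real.exp (-d₂ ^ 2 / (Q * (θ * τ))) := by
      refine hu.trans ?_
      refine mul_le_mul_of_nonneg_right (mul_le_mul_of_nonneg_left ?_ hpos2) (Real.exp_pos _).le
      exact (hcmp v₂).trans (mul_le_mul_of_nonneg_left (hEv v₂ hv₂.2)
        (mul_nonneg (Real.exp_pos _).le (Real.exp_pos _).le))
    have e : 2 * (2 * Z * (θ * τ) ^ (-(m : ℝ) / 2) *
        (Real.exp (-N) * Real.exp (c₂ * θ ^ (-(1 : ℝ) / 2)) * E) * Real.exp (-d₂ ^ 2 / (Q * (θ * τ)))) =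
        4 * Z * k₂ * P * E * Real.exp (-d₂ ^ 2 / (Q * (θ * τ))) := by
      calc _ = 4 * (Z * (θ * τ) ^ (-(m : ℝ) / 2) * (Real.exp (-N) * Real.exp (c₂ * θ ^ (-(1 : ℝ) / 2)))) *
            E * Real.exp (-d₂ ^ 2 / (Q * (θ * τ))) := by ring
        _ = 4 * (Z * k₂ * P) * E * Real.exp (-d₂ ^ 2 / (Q * (θ * τ))) := by rw [hk₂P']
        _ = _ := by ring
    calc a₂ ≤ 2 * hflow.heatKernelFn hh hR tθ v₂ (y₂, s) := hv₂V
      _ ≤ 2 * (2 * Z * (θ * τ) ^ (-(m : ℝ) / 2) *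
          (Real.exp (-N) * Real.exp (c₂ * θ ^ (-(1 : ℝ) / 2)) * E) * Real.exp (-d₂ ^ 2 / (Q * (θ * τ)))) :=
          mul_le_mul_of_nonneg_left hstep zero_le_two
      _ = _ := e
  have hII : a₁ * a₂ ≤ 16 * Z ^ 2 * k₂ ^ 2 * P ^ 2 * E ^ 2 *
      Real.exp (-(d₁ ^ 2 + d₂ ^ 2) / (Q * (θ * τ))) := by
    have h0' : 0 ≤ 4 * Z * k₂ * P * E * Real.exp (-d₂ ^ 2 / (Q * (θ * τ))) :=
      mul_nonneg (mul_nonneg (mul_nonneg (mul_nonneg (mul_nonneg (by norm_num) hZpos.le) hk₂0.le)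
        hP0.le) hE0.le) (Real.exp_pos _).le
    have hmul := mul_le_mul hII₁ hII₂ ha₂pos.le (ha₁pos.le.trans hII₁)
    refine hmul.trans (le_of_eq ?_)
    have e : Real.exp (-d₁ ^ 2 / (Q * (θ * τ))) * Real.exp (-d₂ ^ 2 / (Q * (θ * τ))) =
        Real.exp (-(d₁ ^ 2 + d₂ ^ 2) / (Q * (θ * τ))) := by
      rw [← Real.exp_add]; congr 1; ring
    rw [← e]; ring
  /- ── the distance bookkeeping (7.25): `d ≤ d₁ + d₂ + dv + 2 √(Hm θ τ)` ── -/
  have htri : d ≤ d₁ + d₂ + dv + 2 * Real.sqrt (Hm * θ * τ) := by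
    -- in the tree's vocabulary: `d_s(z₁,z₂) ≤ d_θ(v₁,v₂) + 2 (H (tθ − s))^{1/2}`
    have hzz : (h s).edist (hR s) z₁ z₂ ≤ (h tθ).edist (hR tθ) v₁ v₂ +
        2 * (ENNReal.ofReal (MetricFlow.concentrationConst m * (tθ - s))) ^ (1 / 2 : ℝ) :=
      MetricFlow.IsHCenter.edist_le_edist_add' hz₁ hz₂
    have hzz' : (h s).edist (hR s) z₁ z₂ ≤ (h tθ).edist (hR tθ) v₁ v₂ +
        2 * (ENNReal.ofReal (Hm * (tθ - s))) ^ (1 / 2 : ℝ) := by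
      rwa [hcc] at hzz
    have h3 : (h s).edist (hR s) y₁ y₂ ≤ (h s).edist (hR s) z₁ y₁ + (h tθ).edist (hR tθ) v₁ v₂ +
        2 * (ENNReal.ofReal (Hm * (tθ - s))) ^ (1 / 2 : ℝ) + (h s).edist (hR s) z₂ y₂ := by
      calc (h s).edist (hR s) y₁ y₂ ≤ (h s).edist (hR s) y₁ z₁ + (h s).edist (hR s) z₁ y₂ :=
            (h s).edist_triangle (hR s) y₁ z₁ y₂
        _ ≤ (h s).edist (hR s) y₁ z₁ + ((h s).edist (hR s) z₁ z₂ + (h s).edist (hR s) z₂ y₂) :=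
            add_le_add le_rfl ((h s).edist_triangle (hR s) z₁ z₂ y₂)
        _ ≤ (h s).edist (hR s) y₁ z₁ + (((h tθ).edist (hR tθ) v₁ v₂ +
            2 * (ENNReal.ofReal (Hm * (tθ - s))) ^ (1 / 2 : ℝ)) + (h s).edist (hR s) z₂ y₂) :=
            add_le_add le_rfl (add_le_add hzz' le_rfl)
        _ = _ := by rw [(h s).edist_comm (hR s) y₁ z₁]; ring
    have hfin₁ : (h s).edist (hR s) z₁ y₁ ≠ ⊤ := PseudoRiemannianMetric.edist_ne_top (hR s) z₁ y₁
    have hfin₂ : (h s).edist (hR s) z₂ y₂ ≠ ⊤ := PseudoRiemannianMetric.edist_ne_top (hR s) z₂ y₂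
    have hfinc : (2 * (ENNReal.ofReal (Hm * (tθ - s))) ^ (1 / 2 : ℝ)) ≠ ⊤ :=
      ENNReal.mul_ne_top (by norm_num) (ENNReal.rpow_ne_top_of_nonneg (by norm_num) ENNReal.ofReal_ne_top)
    have hconst : (2 * (ENNReal.ofReal (Hm * (tθ - s))) ^ (1 / 2 : ℝ)).toReal =
        2 * Real.sqrt (Hm * θ * τ) := by
      rw [ENNReal.toReal_mul, ← ENNReal.toReal_rpow, ENNReal.toReal_ofReal
        (mul_nonneg hHm0.le (by rw [htθs]; exact hθτ.le)), Real.sqrt_eq_rpow, htθs, ← mul_assoc]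
      norm_num
    have := ENNReal.toReal_mono (ENNReal.add_ne_top.2 ⟨ENNReal.add_ne_top.2
      ⟨ENNReal.add_ne_top.2 ⟨hfin₁, hdvfin⟩, hfinc⟩, hfin₂⟩) h3
    rw [ENNReal.toReal_add (ENNReal.add_ne_top.2 ⟨ENNReal.add_ne_top.2 ⟨hfin₁, hdvfin⟩, hfinc⟩) hfin₂,
      ENNReal.toReal_add (ENNReal.add_ne_top.2 ⟨hfin₁, hdvfin⟩) hfinc,
      ENNReal.toReal_add hfin₁ hdvfin, hconst] at this
    rw [hd, hd₁, hd₂, hdv]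
    linarith only [this]
  /- ── logarithms of (L0), (I), (II) and the endgame (7.24), (7.26) ── -/
  have hℓ0 : Real.log α + Real.log Z + 2 * Real.log P + (-d ^ 2 / ((8 + ε / 2) * τ)) <
      Real.log (a₁ * a₂) := by
    have h1' := Real.log_lt_log (by exact mul_pos (mul_pos (mul_pos hα hZpos) (pow_pos hP0 2)) hG0) hcon'
    rw [Real.log_mul (mul_pos (mul_pos hα hZpos) (pow_pos hP0 2)).ne' hG0.ne',
      Real.log_mul (mul_pos hα hZpos).ne' (pow_pos hP0 2).ne', Real.log_mul hα.ne' hZpos.ne',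
      Real.log_pow, hG, Real.log_exp] at h1'
    push_cast at h1'
    linarith only [h1']
  have hlE : Real.log E = κ * (10 * d) := by rw [hEdef, Real.log_exp]
  have hℓI : Real.log (a₁ * a₂) < Real.log (8 * Real.exp (1 / 2) * k₁ ^ 2) + 2 * Real.log P +
      2 * (κ * (10 * d)) + (-dv ^ 2 / (8 * σ)) := by
    have hRpos : 0 < 8 * Real.exp (1 / 2) * k₁ ^ 2 := by positivity
    have h1' := Real.log_lt_log (mul_pos ha₁pos ha₂pos) hI
    rw [show 8 * Real.exp (1 / 2) * k₁ ^ 2 * P ^ 2 * E ^ 2 * Real.exp (-dv ^ 2 / (8 * σ)) =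
        (8 * Real.exp (1 / 2) * k₁ ^ 2) * P ^ 2 * E ^ 2 * Real.exp (-dv ^ 2 / (8 * σ)) by ring,
      Real.log_mul (mul_pos (mul_pos hRpos (pow_pos hP0 2)) (pow_pos hE0 2)).ne' (Real.exp_pos _).ne',
      Real.log_mul (mul_pos hRpos (pow_pos hP0 2)).ne' (pow_pos hE0 2).ne',
      Real.log_mul hRpos.ne' (pow_pos hP0 2).ne', Real.log_pow, Real.log_pow, hlE,
      Real.log_exp] at h1'
    push_cast at h1'
    linarith only [h1']
  have hℓII : Real.log (a₁ * a₂) ≤ Real.log (16 * k₂ ^ 2) + 2 * Real.log Z + 2 * Real.log P +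
      2 * (κ * (10 * d)) + (-(d₁ ^ 2 + d₂ ^ 2) / (Q * (θ * τ))) := by
    have hRpos : 0 < 16 * k₂ ^ 2 := by positivity
    have h1' := Real.log_le_log (mul_pos ha₁pos ha₂pos) hII
    rw [show 16 * Z ^ 2 * k₂ ^ 2 * P ^ 2 * E ^ 2 * Real.exp (-(d₁ ^ 2 + d₂ ^ 2) / (Q * (θ * τ))) =
        (16 * k₂ ^ 2) * Z ^ 2 * P ^ 2 * E ^ 2 * Real.exp (-(d₁ ^ 2 + d₂ ^ 2) / (Q * (θ * τ))) by ring,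
      Real.log_mul (mul_pos (mul_pos (mul_pos hRpos (pow_pos hZpos 2)) (pow_pos hP0 2))
        (pow_pos hE0 2)).ne' (Real.exp_pos _).ne',
      Real.log_mul (mul_pos (mul_pos hRpos (pow_pos hZpos 2)) (pow_pos hP0 2)).ne' (pow_pos hE0 2).ne',
      Real.log_mul (mul_pos hRpos (pow_pos hZpos 2)).ne' (pow_pos hP0 2).ne',
      Real.log_mul hRpos.ne' (pow_pos hZpos 2).ne', Real.log_pow, Real.log_pow, Real.log_pow, hlE,
      Real.log_exp] at h1'
    push_cast at h1'
    linarith only [h1']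
  -- combine: `(1 - β) log Z < const + [exponent]`
  have hexpo := gaussianLemma_exponent_le hβ0 hε hQ hθ0 hHm0.le hτ hσ hστ hd0 hdv0 hd₁0 hd₂0 hcoef1
    hcoef2 htri
  have hquad : -cq * (d / Real.sqrt τ) ^ 2 + bq * (d / Real.sqrt τ) ≤ bq ^ 2 / (4 * cq) :=
    neg_mul_sq_add_mul_le hcq0
  -- `κ d = c₁ θ^{-1/2} (d/√τ)` and `d²/τ = (d/√τ)²`
  have hκd : κ * (10 * d) = 10 * c₁ * θ ^ (-(1 : ℝ) / 2) * (d / Real.sqrt τ) := by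
    rw [hκ]; field_simp
  have hdτ : (d / Real.sqrt τ) ^ 2 = d ^ 2 / τ := by rw [div_pow, Real.sq_sqrt hτ.le]
  have hβℓ : β * Real.log (a₁ * a₂) ≤ β * (Real.log (16 * k₂ ^ 2) + 2 * Real.log Z + 2 * Real.log P +
      2 * (κ * (10 * d)) + (-(d₁ ^ 2 + d₂ ^ 2) / (Q * (θ * τ)))) :=
    mul_le_mul_of_nonneg_left hℓII hβ0.le
  -- the final linear combination
  have hmain : (1 - β) * Real.log Z < k₅ := by
    rw [hk₅, hk₄]
    -- unfold the pieces of the exponent bound into the shapes of `hexpo`, `hquad`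
    have e1 : (1 + β) * d ^ 2 / ((8 + ε / 2) * τ) = (1 + β) * (d ^ 2 / ((8 + ε / 2) * τ)) := by ring
    have e2 : -β * (1 + β) * d ^ 2 / ((8 + ε / 2) * τ) = -cq * (d / Real.sqrt τ) ^ 2 := by
      rw [hdτ, hcq]; field_simp
    have e3 : 2 * (1 + β) * (κ * (10 * d)) = bq * (d / Real.sqrt τ) := by
      rw [hκd, hbq]; ring
    have e4 : -(d₁ ^ 2 + d₂ ^ 2) / (Q * (θ * τ)) = -((d₁ ^ 2 + d₂ ^ 2) / (Q * θ * τ)) := by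
      rw [neg_div, mul_assoc]
    have hℓ0' := mul_lt_mul_of_pos_left hℓ0 (show (0 : ℝ) < 1 + β by linarith only [hβ0])
    have h1 : (1 - β) * Real.log Z < Real.log (8 * Real.exp (1 / 2) * k₁ ^ 2) +
        β * Real.log (16 * k₂ ^ 2) - (1 + β) * Real.log α +
        (2 * (1 + β) * (κ * (10 * d)) + (-dv ^ 2 / (8 * σ)) +
          β * (-(d₁ ^ 2 + d₂ ^ 2) / (Q * (θ * τ))) + (1 + β) * (d ^ 2 / ((8 + ε / 2) * τ))) := by
      have h1a := add_lt_add_of_lt_of_le (add_lt_add hℓ0' hℓI) hβℓ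
      have key : Real.log (8 * Real.exp (1 / 2) * k₁ ^ 2) +
          β * Real.log (16 * k₂ ^ 2) - (1 + β) * Real.log α +
          (2 * (1 + β) * (κ * (10 * d)) + (-dv ^ 2 / (8 * σ)) +
            β * (-(d₁ ^ 2 + d₂ ^ 2) / (Q * (θ * τ))) + (1 + β) * (d ^ 2 / ((8 + ε / 2) * τ))) -
          (1 - β) * Real.log Z =
          ((1 + β) * Real.log (a₁ * a₂) + (Real.log (8 * Real.exp (1 / 2) * k₁ ^ 2) +
            2 * Real.log P + 2 * (κ * (10 * d)) + -dv ^ 2 / (8 * σ)) +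
            β * (Real.log (16 * k₂ ^ 2) + 2 * Real.log Z + 2 * Real.log P + 2 * (κ * (10 * d)) +
              -(d₁ ^ 2 + d₂ ^ 2) / (Q * (θ * τ)))) -
          ((1 + β) * (Real.log α + Real.log Z + 2 * Real.log P + -d ^ 2 / ((8 + ε / 2) * τ)) +
            Real.log (a₁ * a₂) + β * Real.log (a₁ * a₂)) := by
        ring
      have h0 : 0 < Real.log (8 * Real.exp (1 / 2) * k₁ ^ 2) +
          β * Real.log (16 * k₂ ^ 2) - (1 + β) * Real.log α +
          (2 * (1 + β) * (κ * (10 * d)) + (-dv ^ 2 / (8 * σ)) +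
            β * (-(d₁ ^ 2 + d₂ ^ 2) / (Q * (θ * τ))) + (1 + β) * (d ^ 2 / ((8 + ε / 2) * τ))) -
          (1 - β) * Real.log Z := by
        rw [key]; exact sub_pos.mpr h1a
      exact sub_pos.mp h0
    have h2 : 2 * (1 + β) * (κ * (10 * d)) + (-dv ^ 2 / (8 * σ)) +
        β * (-(d₁ ^ 2 + d₂ ^ 2) / (Q * (θ * τ))) + (1 + β) * (d ^ 2 / ((8 + ε / 2) * τ)) ≤
        bq ^ 2 / (4 * cq) + 12 * Hm * θ * (1 + β) ^ 3 / (β * (8 + ε / 2)) := by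
      rw [e2] at hexpo
      have h2a := add_le_add hexpo hquad
      have eL : 2 * (1 + β) * (κ * (10 * d)) + (-dv ^ 2 / (8 * σ)) +
          β * (-(d₁ ^ 2 + d₂ ^ 2) / (Q * (θ * τ))) + (1 + β) * (d ^ 2 / ((8 + ε / 2) * τ)) =
          ((1 + β) * d ^ 2 / ((8 + ε / 2) * τ) - dv ^ 2 / (8 * σ) -
            β * (d₁ ^ 2 + d₂ ^ 2) / (Q * θ * τ) + (-cq * (d / Real.sqrt τ) ^ 2 + bq * (d / Real.sqrt τ))) +
          cq * (d / Real.sqrt τ) ^ 2 := by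
        rw [← e3]; ring
      have eR : bq ^ 2 / (4 * cq) + 12 * Hm * θ * (1 + β) ^ 3 / (β * (8 + ε / 2)) =
          ((-cq * (d / Real.sqrt τ) ^ 2 + 12 * Hm * θ * (1 + β) ^ 3 / (β * (8 + ε / 2))) +
            bq ^ 2 / (4 * cq)) + cq * (d / Real.sqrt τ) ^ 2 := by ring
      rw [eL, eR]
      exact add_le_add h2a le_rfl
    linarith only [h1, h2]
  -- contradiction with `Z > Z₄ = exp (k₅ / (1 - β))`
  have hlogZ : k₅ / (1 - β) < Real.log Z := by
    have := Real.log_lt_log hZ₄0 hZ4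
    rwa [hZ₄, Real.log_exp] at this
  have : k₅ < (1 - β) * Real.log Z := by
    have := mul_lt_mul_of_pos_left hlogZ h1β
    rwa [mul_div_cancel₀ _ h1β.ne'] at this
  linarith only [hmain, this]

end AlphaClaim

end Literature.Geometry.Riemannian

end
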